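import Literature.Analysis.Calculus.IteratedDerivCompGevrey
import HarnessLib

/-!
# The Faà di Bruno bound for the DIFFERENCE of two compositions with Gevrey-2 jets:
# `‖Dⁿ(g ∘ f₁ − g ∘ f₀)(x)‖ ≤ A·τ·B_ψ·((n+s+1)!)²·(4σ(1+τB))ⁿ` when `ψ = f₁ − f₀` has jets `B_ψ·(i!)²·σⁱ`

Topic `Analysis/Calculus`; the companion of `IteratedDerivCompGevrey` (`norm_iteratedFDeriv_comp_le_of_gevrey_two`) for DIFFERENCES.  In fermionic
renormalisation the response of a dressed propagator symbol to a shift of the Fermi surface is a difference `g(f₁(q)) − g(f₀(q))` of two compositions of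
the same Gevrey outer function (cutoff × resolvent) with two nearby bands `f₁ = f₀ + ψ`; its momentum jets must carry the SIZE OF THE SHIFT `ψ` — one factor
`B_ψ` — and not merely the triangle bound `‖Dⁿ(g∘f₁)‖ + ‖Dⁿ(g∘f₀)‖` (Benfatto–Giuliani–Mastropietro 2006 §2.3 (2.21)–(2.24), the frame-response terms;
Disertori–Rivasseau 2000 App. A for the Gevrey cutoff class).  The classical device: `D(g∘f₁ − g∘f₀) = (Dg∘f₁ − Dg∘f₀)·Df₁ + (Dg∘f₀)·Dψ` — the first term has
the same shape one order down (outer function `Dg`, shift `s+1`, amplitude `Aτ`), the second is a plain composition times a jet of `ψ`; the order-`0` case is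
the mean value inequality.  The SAME geometric-factorial series as in the composition lemma closes the induction (`(4/9)·τB/(1+τB) + (1/9) < 1`).

* `gevreyTwo_step_sum_le` — the series `Σ_i C(n,i)((i+s+1)!)²θⁱ((n−i+1)!)²σ^{n−i+1} ≤ ((n+1+s)!)²θ^{n+1}·(4/9)/(1+τB)`, `θ = 4σ(1+τB)`;
* **`norm_iteratedFDeriv_comp_sub_comp_le_of_gevrey_two`** — the bound above, at a point `x`, for `C^∞` maps between real normed spaces, from SUP jets of
  `g` of orders `1 … n+1` (`‖Dᵏg(y)‖ ≤ A((k+s)!)²τᵏ` for all `y`), point jets of `f₀, f₁` (`B(i!)²σⁱ`, `1 ≤ i ≤ n`) and of `ψ = f₁ − f₀` (`B_ψ(i!)²σⁱ`, `i ≤ n`).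

Everything is proved; no definitions; no named facts.

## Sources

G. Benfatto, A. Giuliani, V. Mastropietro, Ann. Henri Poincaré 7 (2006) 809–898, §2.3 (2.21)–(2.24), §3 (3.2)–(3.8) (`BenfattoGiulianiMastropietro2006`);
M. Disertori, V. Rivasseau, Commun. Math. Phys. 215 (2000) 251–290, App. A Lemma 11 (`DisertoriRivasseau2000`); the mean value inequality, chain rule and
Leibniz bounds are Mathlib's (`Convex.norm_image_sub_le_of_norm_fderiv_le`, `fderiv_comp`, `ContinuousLinearMap.norm_iteratedFDeriv_le_of_bilinear`).
-/

noncomputable section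

namespace Literature.Analysis.Calculus

open Finset
open scoped Nat

universe u

variable {E : Type*} [NormedAddCommGroup E] [NormedSpace ℝ E]

/-- **The geometric-factorial series of the Gevrey-2 chain rule**: with `θ = 4σ(1+c)` (`σ, c ≥ 0`),
`Σ_{i≤n} C(n,i)·((i+s+1)!)²·θⁱ·((n−i+1)!)²·σ^{n−i+1} ≤ ((n+1+s)!)²·θ^{n+1}·(4/9)/(1+c)`. [cite: BenfattoGiulianiMastropietro2006, §3 (3.2)] -/
theorem gevreyTwo_step_sum_le {σ c : ℝ} (hσ : 0 ≤ σ) (hc : 0 ≤ c) (n s : ℕ) :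
    ∑ i ∈ range (n + 1), (n.choose i : ℝ) * ((i + (s + 1)) ! : ℝ) ^ 2 * (4 * σ * (1 + c)) ^ i * (((n - i + 1) ! : ℝ) ^ 2 * σ ^ (n - i + 1)) ≤
      ((n + 1 + s) ! : ℝ) ^ 2 * (4 * σ * (1 + c)) ^ (n + 1) * (4 / 9 / (1 + c)) := by
  set θ : ℝ := 4 * σ * (1 + c) with hθ
  have hθ0 : 0 ≤ θ := by rw [hθ]; positivity
  -- termwise: the factorial comparison and the power bookkeeping
  have hterm : ∀ i ∈ range (n + 1), (n.choose i : ℝ) * ((i + (s + 1)) ! : ℝ) ^ 2 * θ ^ i * (((n - i + 1) ! : ℝ) ^ 2 * σ ^ (n - i + 1)) ≤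
      ((n + 1 + s) ! : ℝ) ^ 2 * θ ^ (n + 1) * ((((n - i : ℕ) : ℝ) + 1) * (σ / θ) ^ (n - i + 1)) := by
    intro i hi
    have hin : i ≤ n := Nat.lt_succ_iff.1 (mem_range.1 hi)
    have hfac : (n.choose i : ℝ) * ((i + (s + 1)) ! : ℝ) * ((n - i + 1) ! : ℝ) ≤ (((n - i : ℕ) : ℝ) + 1) * ((n + 1 + s) ! : ℝ) := by
      have h1 : (n.choose i : ℝ) * ((n - i + 1) ! : ℝ) * (i ! : ℝ) = (((n - i : ℕ) : ℝ) + 1) * (n ! : ℝ) := by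
        have h := Nat.choose_mul_factorial_mul_factorial hin
        have h' : ((n.choose i : ℕ) : ℝ) * (i ! : ℝ) * ((n - i) ! : ℝ) = n ! := by exact_mod_cast h
        rw [Nat.factorial_succ]
        push_cast
        nlinarith [h']
      have h2 : ((i + (s + 1)) ! : ℝ) * (n ! : ℝ) ≤ ((n + 1 + s) ! : ℝ) * (i ! : ℝ) := by
        have key : ∀ t : ℕ, (i + t) ! * n ! ≤ (n + t) ! * i ! := by
          intro t
          induction t with
          | zero => simp [mul_comm]
          | succ t iht =>
            rw [show i + (t + 1) = (i + t) + 1 by ring, show n + (t + 1) = (n + t) + 1 by ring, Nat.factorial_succ, Nat.factorial_succ,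
              mul_assoc, mul_assoc]
            exact Nat.mul_le_mul (by omega) iht
        have := key (s + 1)
        rw [show n + 1 + s = n + (s + 1) by ring]
        exact_mod_cast this
      have h3 : (n.choose i : ℝ) * ((i + (s + 1)) ! : ℝ) * ((n - i + 1) ! : ℝ) * ((i ! : ℝ) * (n ! : ℝ)) ≤
          (((n - i : ℕ) : ℝ) + 1) * ((n + 1 + s) ! : ℝ) * ((i ! : ℝ) * (n ! : ℝ)) := by
        calc (n.choose i : ℝ) * ((i + (s + 1)) ! : ℝ) * ((n - i + 1) ! : ℝ) * ((i ! : ℝ) * (n ! : ℝ))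
            = ((n.choose i : ℝ) * ((n - i + 1) ! : ℝ) * (i ! : ℝ)) * (((i + (s + 1)) ! : ℝ) * (n ! : ℝ)) := by ring
          _ = ((((n - i : ℕ) : ℝ) + 1) * (n ! : ℝ)) * (((i + (s + 1)) ! : ℝ) * (n ! : ℝ)) := by rw [h1]
          _ ≤ ((((n - i : ℕ) : ℝ) + 1) * (n ! : ℝ)) * (((n + 1 + s) ! : ℝ) * (i ! : ℝ)) := by gcongr
          _ = (((n - i : ℕ) : ℝ) + 1) * ((n + 1 + s) ! : ℝ) * ((i ! : ℝ) * (n ! : ℝ)) := by ring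
      exact le_of_mul_le_mul_right h3 (by positivity)
    have hpair : ((i + (s + 1)) ! : ℝ) * ((n - i + 1) ! : ℝ) ≤ ((n + 1 + s) ! : ℝ) := by
      have h := factorial_succ_mul_factorial_succ_le (i + s) (n - i)
      rw [show i + s + 1 = i + (s + 1) by ring, show i + s + (n - i) + 1 = n + 1 + s by omega] at h
      exact_mod_cast h
    have hfac2 : (n.choose i : ℝ) * ((i + (s + 1)) ! : ℝ) ^ 2 * ((n - i + 1) ! : ℝ) ^ 2 ≤ (((n - i : ℕ) : ℝ) + 1) * ((n + 1 + s) ! : ℝ) ^ 2 := by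
      have hnn : 0 ≤ ((i + (s + 1)) ! : ℝ) * ((n - i + 1) ! : ℝ) := by positivity
      calc (n.choose i : ℝ) * ((i + (s + 1)) ! : ℝ) ^ 2 * ((n - i + 1) ! : ℝ) ^ 2
          = ((n.choose i : ℝ) * ((i + (s + 1)) ! : ℝ) * ((n - i + 1) ! : ℝ)) * (((i + (s + 1)) ! : ℝ) * ((n - i + 1) ! : ℝ)) := by ring
        _ ≤ ((((n - i : ℕ) : ℝ) + 1) * ((n + 1 + s) ! : ℝ)) * ((n + 1 + s) ! : ℝ) := mul_le_mul hfac hpair hnn (by positivity)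
        _ = (((n - i : ℕ) : ℝ) + 1) * ((n + 1 + s) ! : ℝ) ^ 2 := by ring
    by_cases hσ0 : σ = 0
    · have : σ ^ (n - i + 1) = 0 := by rw [hσ0]; exact zero_pow (by omega)
      rw [this, mul_zero, mul_zero]
      positivity
    have hσp : 0 < σ := lt_of_le_of_ne hσ (Ne.symm hσ0)
    have hθp : 0 < θ := by rw [hθ]; positivity
    have hpow : θ ^ i * σ ^ (n - i + 1) = θ ^ (n + 1) * (σ / θ) ^ (n - i + 1) := by
      rw [div_pow, show n + 1 = i + (n - i + 1) by omega, pow_add]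
      field_simp
      rw [← pow_add]
    calc (n.choose i : ℝ) * ((i + (s + 1)) ! : ℝ) ^ 2 * θ ^ i * (((n - i + 1) ! : ℝ) ^ 2 * σ ^ (n - i + 1))
        = ((n.choose i : ℝ) * ((i + (s + 1)) ! : ℝ) ^ 2 * ((n - i + 1) ! : ℝ) ^ 2) * (θ ^ i * σ ^ (n - i + 1)) := by ring
      _ ≤ ((((n - i : ℕ) : ℝ) + 1) * ((n + 1 + s) ! : ℝ) ^ 2) * (θ ^ i * σ ^ (n - i + 1)) := by gcongr
      _ = ((n + 1 + s) ! : ℝ) ^ 2 * θ ^ (n + 1) * ((((n - i : ℕ) : ℝ) + 1) * (σ / θ) ^ (n - i + 1)) := by rw [hpow]; ring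
  -- the geometric-arithmetic series
  have hS : ∑ i ∈ range (n + 1), (((n - i : ℕ) : ℝ) + 1) * (σ / θ) ^ (n - i + 1) ≤ 4 / 9 / (1 + c) := by
    by_cases hσ0 : σ = 0
    · have hz : ∀ i ∈ range (n + 1), (((n - i : ℕ) : ℝ) + 1) * (σ / θ) ^ (n - i + 1) = 0 := by
        intro i _; rw [hσ0, zero_div, zero_pow (by omega)]; ring
      rw [sum_congr rfl hz, sum_const_zero]; positivity
    have hσp : 0 < σ := lt_of_le_of_ne hσ (Ne.symm hσ0)
    have hθp : 0 < θ := by rw [hθ]; positivity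
    set r : ℝ := σ / θ with hr
    have hr0 : 0 ≤ r := by positivity
    have hr_eq : r = 1 / (4 * (1 + c)) := by rw [hr, hθ]; field_simp
    have h1c : 1 ≤ 1 + c := le_add_of_nonneg_right hc
    have hr4 : r ≤ 1 / 4 := by rw [hr_eq]; rw [div_le_div_iff₀ (by positivity) (by norm_num)]; linarith
    have hr1 : r < 1 := by linarith
    have hreindex : ∑ i ∈ range (n + 1), (((n - i : ℕ) : ℝ) + 1) * r ^ (n - i + 1) = ∑ m ∈ range (n + 1), ((m : ℝ) + 1) * r ^ (m + 1) := by
      rw [← sum_range_reflect]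
      refine sum_congr rfl fun i hi => ?_
      have hin : i ≤ n := Nat.lt_succ_iff.1 (mem_range.1 hi)
      rw [show n + 1 - 1 - i = n - i by omega, show n - (n - i) = i by omega]
    rw [hreindex]
    have hgeo := sum_range_succ_mul_geometric_le hr0 hr1 n
    have h34 : (3 / 4 : ℝ) ≤ 1 - r := by linarith
    have hden : r / (1 - r) ^ 2 ≤ r / (3 / 4) ^ 2 := div_le_div_of_nonneg_left hr0 (by positivity) (pow_le_pow_left₀ (by norm_num) h34 2)
    have hval : r / (3 / 4) ^ 2 = 4 / 9 / (1 + c) := by rw [hr_eq]; field_simp; ring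
    calc ∑ m ∈ range (n + 1), ((m : ℝ) + 1) * r ^ (m + 1) ≤ r / (1 - r) ^ 2 := hgeo
      _ ≤ r / (3 / 4) ^ 2 := hden
      _ = 4 / 9 / (1 + c) := hval
  refine (sum_le_sum hterm).trans ?_
  rw [← mul_sum]
  exact mul_le_mul_of_nonneg_left hS (by positivity)

/-- **DIFFERENCE OF COMPOSITIONS WITH GEVREY-2 GEOMETRIC JETS.**  Let `f₀ f₁ : E → F` and `g : F → G` be `C^∞` (`F`, `G` real normed spaces), `ψ = f₁ − f₀`.
If at `x` `‖Dⁱf₀(x)‖, ‖Dⁱf₁(x)‖ ≤ B·(i!)²·σⁱ` for `1 ≤ i ≤ n`, `‖Dⁱψ(x)‖ ≤ B_ψ·(i!)²·σⁱ` for `i ≤ n`, and EVERYWHERE `‖Dᵏg(y)‖ ≤ A·((k+s)!)²·τᵏ` for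
`1 ≤ k ≤ n+1` (`A, B, B_ψ, σ, τ ≥ 0`, `s : ℕ` a shift), then
`‖Dⁿ(g ∘ f₁ − g ∘ f₀)(x)‖ ≤ A·τ·B_ψ·((n+s+1)!)²·(4σ(1+τB))ⁿ` — ONE factor `B_ψ` (the size of the shift), the same ratio as the composition lemma.
[cite: BenfattoGiulianiMastropietro2006, §3 (3.2)] -/
theorem norm_iteratedFDeriv_comp_sub_comp_le_of_gevrey_two {F G : Type u} [NormedAddCommGroup F] [NormedSpace ℝ F] [NormedAddCommGroup G]
    [NormedSpace ℝ G] {f₀ f₁ : E → F} (hf₀ : ContDiff ℝ (⊤ : ℕ∞) f₀) (hf₁ : ContDiff ℝ (⊤ : ℕ∞) f₁) (x : E) {B Bψ σ τ : ℝ} (hB : 0 ≤ B)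
    (hBψ : 0 ≤ Bψ) (hσ : 0 ≤ σ) (hτ : 0 ≤ τ) (n : ℕ)
    (hDf₀ : ∀ i, 1 ≤ i → i ≤ n → ‖iteratedFDeriv ℝ i f₀ x‖ ≤ B * (i ! : ℝ) ^ 2 * σ ^ i)
    (hDf₁ : ∀ i, 1 ≤ i → i ≤ n → ‖iteratedFDeriv ℝ i f₁ x‖ ≤ B * (i ! : ℝ) ^ 2 * σ ^ i)
    (hDψ : ∀ i ≤ n, ‖iteratedFDeriv ℝ i (fun y => f₁ y - f₀ y) x‖ ≤ Bψ * (i ! : ℝ) ^ 2 * σ ^ i)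
    {g : F → G} (hg : ContDiff ℝ (⊤ : ℕ∞) g) {A : ℝ} (hA : 0 ≤ A) (s : ℕ)
    (hDg : ∀ k, 1 ≤ k → k ≤ n + 1 → ∀ y : F, ‖iteratedFDeriv ℝ k g y‖ ≤ A * ((k + s) ! : ℝ) ^ 2 * τ ^ k) :
    ‖iteratedFDeriv ℝ n (fun y => g (f₁ y) - g (f₀ y)) x‖ ≤ A * τ * Bψ * ((n + s + 1) ! : ℝ) ^ 2 * (4 * σ * (1 + τ * B)) ^ n := by
  induction n using Nat.strong_induction_on generalizing G g A s with
  | _ n ih =>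
    rcases n with _ | n
    · -- order 0: the mean value inequality along the segment `[f₀ x, f₁ x]`
      simp only [pow_zero, mul_one, zero_add]
      rw [norm_iteratedFDeriv_zero]
      have hψ0 := hDψ 0 le_rfl
      rw [norm_iteratedFDeriv_zero] at hψ0
      simp only [Nat.factorial_zero, Nat.cast_one, one_pow, mul_one, pow_zero] at hψ0
      have hDg1 : ∀ y : F, ‖fderiv ℝ g y‖ ≤ A * (((s + 1)) ! : ℝ) ^ 2 * τ := by
        intro y
        have h := hDg 1 le_rfl le_rfl y
        have e : ‖fderiv ℝ g y‖ = ‖iteratedFDeriv ℝ 1 g y‖ := by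
          rw [← norm_iteratedFDeriv_fderiv, norm_iteratedFDeriv_zero]
        rw [e, show s + 1 = 1 + s from add_comm _ _]
        simpa [pow_one] using h
      have hmvt : ‖g (f₁ x) - g (f₀ x)‖ ≤ (A * ((s + 1) ! : ℝ) ^ 2 * τ) * ‖f₁ x - f₀ x‖ :=
        Convex.norm_image_sub_le_of_norm_fderiv_le (s := Set.univ) (fun y _ => (hg.differentiable (by simp)).differentiableAt) (fun y _ => hDg1 y)
          convex_univ (Set.mem_univ _) (Set.mem_univ _)
      calc ‖g (f₁ x) - g (f₀ x)‖ ≤ (A * ((s + 1) ! : ℝ) ^ 2 * τ) * ‖f₁ x - f₀ x‖ := hmvt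
        _ ≤ (A * ((s + 1) ! : ℝ) ^ 2 * τ) * Bψ := mul_le_mul_of_nonneg_left hψ0 (by positivity)
        _ = A * τ * Bψ * ((s + 1) ! : ℝ) ^ 2 := by ring
    · -- order n+1: `D(g∘f₁ − g∘f₀) = compL(Dg∘f₁ − Dg∘f₀)(Df₁) + compL(Dg∘f₀)(Dψ)`
      set θ : ℝ := 4 * σ * (1 + τ * B) with hθ
      have hθ0 : 0 ≤ θ := by rw [hθ]; positivity
      have hψ : ContDiff ℝ (⊤ : ℕ∞) (fun y => f₁ y - f₀ y) := hf₁.sub hf₀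
      have hf1' : ContDiff ℝ (⊤ : ℕ∞) (fderiv ℝ f₁) := hf₁.fderiv_right le_rfl
      have hψ1 : ContDiff ℝ (⊤ : ℕ∞) (fderiv ℝ (fun y => f₁ y - f₀ y)) := hψ.fderiv_right le_rfl
      have hg1 : ContDiff ℝ (⊤ : ℕ∞) (fderiv ℝ g) := hg.fderiv_right le_rfl
      have hΔ : ContDiff ℝ (⊤ : ℕ∞) (fun y => fderiv ℝ g (f₁ y) - fderiv ℝ g (f₀ y)) := (hg1.comp hf₁).sub (hg1.comp hf₀)
      have hg1f₀ : ContDiff ℝ (⊤ : ℕ∞) (fun y => fderiv ℝ g (f₀ y)) := hg1.comp hf₀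
      have hdiff : Differentiable ℝ g := hg.differentiable (by simp)
      have hderiv : fderiv ℝ (fun y => g (f₁ y) - g (f₀ y)) = fun y =>
          ContinuousLinearMap.compL ℝ E F G (fderiv ℝ g (f₁ y) - fderiv ℝ g (f₀ y)) (fderiv ℝ f₁ y) +
            ContinuousLinearMap.compL ℝ E F G (fderiv ℝ g (f₀ y)) (fderiv ℝ (fun y => f₁ y - f₀ y) y) := by
        funext y
        have h1 : DifferentiableAt ℝ (fun y => g (f₁ y)) y := (hdiff _).comp y (hf₁.differentiable (by simp) _)
        have h0 : DifferentiableAt ℝ (fun y => g (f₀ y)) y := (hdiff _).comp y (hf₀.differentiable (by simp) _)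
        rw [fderiv_fun_sub h1 h0, fderiv_fun_sub (hf₁.differentiable (by simp) _) (hf₀.differentiable (by simp) _)]
        rw [show (fun y => g (f₁ y)) = g ∘ f₁ from rfl, show (fun y => g (f₀ y)) = g ∘ f₀ from rfl,
          fderiv_comp y (hdiff _) (hf₁.differentiable (by simp) _), fderiv_comp y (hdiff _) (hf₀.differentiable (by simp) _)]
        simp only [ContinuousLinearMap.compL_apply, ContinuousLinearMap.sub_comp, ContinuousLinearMap.comp_sub]
        abel
      rw [← norm_iteratedFDeriv_fderiv, hderiv]
      have hN : ((n : ℕ∞) : WithTop ℕ∞) ≤ ((⊤ : ℕ∞) : WithTop ℕ∞) := by exact_mod_cast le_top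
      have hc1 : ContDiff ℝ (⊤ : ℕ∞) (fun y => ContinuousLinearMap.compL ℝ E F G (fderiv ℝ g (f₁ y) - fderiv ℝ g (f₀ y)) (fderiv ℝ f₁ y)) :=
        (ContinuousLinearMap.compL ℝ E F G).isBoundedBilinearMap.contDiff.comp₂ hΔ hf1'
      have hc2 : ContDiff ℝ (⊤ : ℕ∞) (fun y => ContinuousLinearMap.compL ℝ E F G (fderiv ℝ g (f₀ y)) (fderiv ℝ (fun y => f₁ y - f₀ y) y)) :=
        (ContinuousLinearMap.compL ℝ E F G).isBoundedBilinearMap.contDiff.comp₂ hg1f₀ hψ1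
      rw [fun_iteratedFDeriv_add_apply (hc1.contDiffAt.of_le (by exact_mod_cast le_top)) (hc2.contDiffAt.of_le (by exact_mod_cast le_top))]
      refine (norm_add_le _ _).trans ?_
      -- TERM 1: the difference one order down (IH) against the jets of `f₁`
      have hT1 : ‖iteratedFDeriv ℝ n (fun y => ContinuousLinearMap.compL ℝ E F G (fderiv ℝ g (f₁ y) - fderiv ℝ g (f₀ y)) (fderiv ℝ f₁ y)) x‖ ≤
          A * τ * Bψ * ((n + 1 + s + 1) ! : ℝ) ^ 2 * θ ^ (n + 1) * (τ * B * (4 / 9 / (1 + τ * B))) := by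
        refine ((ContinuousLinearMap.compL ℝ E F G).norm_iteratedFDeriv_le_of_bilinear hΔ hf1' x (n := n) hN).trans ?_
        have hterm : ∀ i ∈ range (n + 1), (n.choose i : ℝ) * ‖iteratedFDeriv ℝ i (fun y => fderiv ℝ g (f₁ y) - fderiv ℝ g (f₀ y)) x‖ *
            ‖iteratedFDeriv ℝ (n - i) (fderiv ℝ f₁) x‖ ≤
            (A * τ * (τ * Bψ) * B) * ((n.choose i : ℝ) * ((i + ((s + 1) + 1)) ! : ℝ) ^ 2 * θ ^ i * (((n - i + 1) ! : ℝ) ^ 2 * σ ^ (n - i + 1))) := by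
          intro i hi
          have hin : i ≤ n := Nat.lt_succ_iff.1 (mem_range.1 hi)
          -- IH at order `i` for the outer function `fderiv g` (shift `s+1`, amplitude `A·τ`)
          have hIH : ‖iteratedFDeriv ℝ i (fun y => fderiv ℝ g (f₁ y) - fderiv ℝ g (f₀ y)) x‖ ≤
              A * τ * τ * Bψ * ((i + (s + 1) + 1) ! : ℝ) ^ 2 * θ ^ i := by
            refine ih i (Nat.lt_succ_of_le hin) (fun j hj1 hji => hDf₀ j hj1 (hji.trans (Nat.le_succ_of_le hin)))
              (fun j hj1 hji => hDf₁ j hj1 (hji.trans (Nat.le_succ_of_le hin))) (fun j hji => hDψ j (hji.trans (Nat.le_succ_of_le hin)))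
              hg1 (mul_nonneg hA hτ) (s + 1) ?_
            intro k hk1 hki y
            rw [norm_iteratedFDeriv_fderiv]
            refine (hDg (k + 1) (by omega) (by omega) y).trans (le_of_eq ?_)
            rw [show k + 1 + s = k + (s + 1) by ring, pow_succ]
            ring
          have hDf' : ‖iteratedFDeriv ℝ (n - i) (fderiv ℝ f₁) x‖ ≤ B * ((n - i + 1) ! : ℝ) ^ 2 * σ ^ (n - i + 1) := by
            rw [norm_iteratedFDeriv_fderiv]
            exact hDf₁ (n - i + 1) (by omega) (by omega)
          calc (n.choose i : ℝ) * ‖iteratedFDeriv ℝ i (fun y => fderiv ℝ g (f₁ y) - fderiv ℝ g (f₀ y)) x‖ * ‖iteratedFDeriv ℝ (n - i) (fderiv ℝ f₁) x‖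
              ≤ (n.choose i : ℝ) * (A * τ * τ * Bψ * ((i + (s + 1) + 1) ! : ℝ) ^ 2 * θ ^ i) * (B * ((n - i + 1) ! : ℝ) ^ 2 * σ ^ (n - i + 1)) := by
                gcongr
            _ = (A * τ * (τ * Bψ) * B) * ((n.choose i : ℝ) * ((i + ((s + 1) + 1)) ! : ℝ) ^ 2 * θ ^ i * (((n - i + 1) ! : ℝ) ^ 2 * σ ^ (n - i + 1))) := by
                rw [show i + (s + 1) + 1 = i + ((s + 1) + 1) by ring]; ring
        refine (mul_le_mul (ContinuousLinearMap.norm_compL_le ℝ E F G) (sum_le_sum hterm) (sum_nonneg fun i _ => by positivity)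
          zero_le_one).trans ?_
        rw [one_mul, ← mul_sum]
        have hGS := gevreyTwo_step_sum_le hσ (mul_nonneg hτ hB) n (s + 1)
        rw [← hθ] at hGS
        calc (A * τ * (τ * Bψ) * B) * ∑ i ∈ range (n + 1), (n.choose i : ℝ) * ((i + ((s + 1) + 1)) ! : ℝ) ^ 2 * θ ^ i * (((n - i + 1) ! : ℝ) ^ 2 * σ ^ (n - i + 1))
            ≤ (A * τ * (τ * Bψ) * B) * (((n + 1 + (s + 1)) ! : ℝ) ^ 2 * θ ^ (n + 1) * (4 / 9 / (1 + τ * B))) :=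
              mul_le_mul_of_nonneg_left hGS (by positivity)
          _ = A * τ * Bψ * ((n + 1 + s + 1) ! : ℝ) ^ 2 * θ ^ (n + 1) * (τ * B * (4 / 9 / (1 + τ * B))) := by
              rw [show n + 1 + (s + 1) = n + 1 + s + 1 by ring]; ring
      -- TERM 2: the plain composition `Dg ∘ f₀` (the composition lemma) against the jets of `ψ`
      have hT2 : ‖iteratedFDeriv ℝ n (fun y => ContinuousLinearMap.compL ℝ E F G (fderiv ℝ g (f₀ y)) (fderiv ℝ (fun y => f₁ y - f₀ y) y)) x‖ ≤
          A * τ * Bψ * ((n + 1 + s + 1) ! : ℝ) ^ 2 * θ ^ (n + 1) * (1 / 9) := by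
        refine ((ContinuousLinearMap.compL ℝ E F G).norm_iteratedFDeriv_le_of_bilinear hg1f₀ hψ1 x (n := n) hN).trans ?_
        have hterm : ∀ i ∈ range (n + 1), (n.choose i : ℝ) * ‖iteratedFDeriv ℝ i (fun y => fderiv ℝ g (f₀ y)) x‖ *
            ‖iteratedFDeriv ℝ (n - i) (fderiv ℝ (fun y => f₁ y - f₀ y)) x‖ ≤
            (A * τ * Bψ) * ((n.choose i : ℝ) * ((i + (s + 1)) ! : ℝ) ^ 2 * θ ^ i * (((n - i + 1) ! : ℝ) ^ 2 * σ ^ (n - i + 1))) := by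
          intro i hi
          have hin : i ≤ n := Nat.lt_succ_iff.1 (mem_range.1 hi)
          -- the composition lemma at order `i` for the outer function `fderiv g` (shift `s+1`, amplitude `A·τ`)
          have hC : ‖iteratedFDeriv ℝ i ((fun z => fderiv ℝ g z) ∘ f₀) x‖ ≤ A * τ * ((i + (s + 1)) ! : ℝ) ^ 2 * θ ^ i := by
            refine norm_iteratedFDeriv_comp_le_of_gevrey_two hf₀ x hB hσ hτ i (fun j hj1 hji => hDf₀ j hj1 (hji.trans (Nat.le_succ_of_le hin)))
              hg1 (A * τ) (s + 1) ?_
            intro k hk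
            rw [norm_iteratedFDeriv_fderiv]
            refine (hDg (k + 1) (by omega) (by omega) _).trans (le_of_eq ?_)
            rw [show k + 1 + s = k + (s + 1) by ring, pow_succ]
            ring
          have hC' : ‖iteratedFDeriv ℝ i (fun y => fderiv ℝ g (f₀ y)) x‖ ≤ A * τ * ((i + (s + 1)) ! : ℝ) ^ 2 * θ ^ i := hC
          have hDψ' : ‖iteratedFDeriv ℝ (n - i) (fderiv ℝ (fun y => f₁ y - f₀ y)) x‖ ≤ Bψ * ((n - i + 1) ! : ℝ) ^ 2 * σ ^ (n - i + 1) := by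
            rw [norm_iteratedFDeriv_fderiv]
            exact hDψ (n - i + 1) (by omega)
          calc (n.choose i : ℝ) * ‖iteratedFDeriv ℝ i (fun y => fderiv ℝ g (f₀ y)) x‖ * ‖iteratedFDeriv ℝ (n - i) (fderiv ℝ (fun y => f₁ y - f₀ y)) x‖
              ≤ (n.choose i : ℝ) * (A * τ * ((i + (s + 1)) ! : ℝ) ^ 2 * θ ^ i) * (Bψ * ((n - i + 1) ! : ℝ) ^ 2 * σ ^ (n - i + 1)) := by
                gcongr
            _ = (A * τ * Bψ) * ((n.choose i : ℝ) * ((i + (s + 1)) ! : ℝ) ^ 2 * θ ^ i * (((n - i + 1) ! : ℝ) ^ 2 * σ ^ (n - i + 1))) := by ring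
        refine (mul_le_mul (ContinuousLinearMap.norm_compL_le ℝ E F G) (sum_le_sum hterm) (sum_nonneg fun i _ => by positivity)
          zero_le_one).trans ?_
        rw [one_mul, ← mul_sum]
        have hGS := gevreyTwo_step_sum_le hσ (mul_nonneg hτ hB) n s
        rw [← hθ] at hGS
        have h1tb : (1 : ℝ) ≤ 1 + τ * B := le_add_of_nonneg_right (by positivity)
        have hquo : 4 / 9 / (1 + τ * B) ≤ 4 / 9 := div_le_self (by norm_num) h1tb
        have hfac4 : 4 * ((n + 1 + s) ! : ℝ) ^ 2 ≤ ((n + 1 + s + 1) ! : ℝ) ^ 2 := by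
          rw [Nat.factorial_succ (n + 1 + s)]
          push_cast
          have h2 : (2 : ℝ) ≤ (n : ℝ) + 1 + s + 1 := by
            have : (0 : ℝ) ≤ (n : ℝ) + s := by positivity
            linarith
          have hf0 : (0 : ℝ) ≤ ((n + 1 + s) ! : ℝ) := by positivity
          have hx : 2 * ((n + 1 + s) ! : ℝ) ≤ ((n : ℝ) + 1 + s + 1) * ((n + 1 + s) ! : ℝ) := mul_le_mul_of_nonneg_right h2 hf0
          calc 4 * ((n + 1 + s) ! : ℝ) ^ 2 = (2 * ((n + 1 + s) ! : ℝ)) ^ 2 := by ring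
            _ ≤ (((n : ℝ) + 1 + s + 1) * ((n + 1 + s) ! : ℝ)) ^ 2 := pow_le_pow_left₀ (by positivity) hx 2
        calc (A * τ * Bψ) * ∑ i ∈ range (n + 1), (n.choose i : ℝ) * ((i + (s + 1)) ! : ℝ) ^ 2 * θ ^ i * (((n - i + 1) ! : ℝ) ^ 2 * σ ^ (n - i + 1))
            ≤ (A * τ * Bψ) * (((n + 1 + s) ! : ℝ) ^ 2 * θ ^ (n + 1) * (4 / 9 / (1 + τ * B))) := mul_le_mul_of_nonneg_left hGS (by positivity)
          _ ≤ (A * τ * Bψ) * (((n + 1 + s) ! : ℝ) ^ 2 * θ ^ (n + 1) * (4 / 9)) := by gcongr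
          _ = (A * τ * Bψ) * ((4 * ((n + 1 + s) ! : ℝ) ^ 2) * θ ^ (n + 1)) * (1 / 9) := by ring
          _ ≤ (A * τ * Bψ) * (((n + 1 + s + 1) ! : ℝ) ^ 2 * θ ^ (n + 1)) * (1 / 9) := by gcongr
          _ = A * τ * Bψ * ((n + 1 + s + 1) ! : ℝ) ^ 2 * θ ^ (n + 1) * (1 / 9) := by ring
      -- total: `(4/9)·τB/(1+τB) + 1/9 ≤ 5/9 ≤ 1`
      have hfrac : τ * B * (4 / 9 / (1 + τ * B)) ≤ 4 / 9 := by
        have h1tb : (0 : ℝ) < 1 + τ * B := by positivity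
        rw [show τ * B * (4 / 9 / (1 + τ * B)) = 4 / 9 * (τ * B / (1 + τ * B)) by field_simp]
        have : τ * B / (1 + τ * B) ≤ 1 := by rw [div_le_one h1tb]; linarith
        linarith
      have hT0 : 0 ≤ A * τ * Bψ * ((n + 1 + s + 1) ! : ℝ) ^ 2 * θ ^ (n + 1) := by positivity
      calc _ ≤ A * τ * Bψ * ((n + 1 + s + 1) ! : ℝ) ^ 2 * θ ^ (n + 1) * (τ * B * (4 / 9 / (1 + τ * B))) +
            A * τ * Bψ * ((n + 1 + s + 1) ! : ℝ) ^ 2 * θ ^ (n + 1) * (1 / 9) := add_le_add hT1 hT2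
        _ ≤ A * τ * Bψ * ((n + 1 + s + 1) ! : ℝ) ^ 2 * θ ^ (n + 1) * (4 / 9) + A * τ * Bψ * ((n + 1 + s + 1) ! : ℝ) ^ 2 * θ ^ (n + 1) * (1 / 9) := by
            gcongr
        _ ≤ A * τ * Bψ * ((n + 1 + s + 1) ! : ℝ) ^ 2 * θ ^ (n + 1) := by nlinarith

end Literature.Analysis.Calculus

end
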